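import Literature.Probability.RandomPlanarGeometry.HexSAWStripBridgeRenewal
import Literature.Analysis.Matrix.NonnegMatrixFamilyNeumannBound
import Literature.Analysis.Matrix.NonnegMatrixFamilyResidue
import Literature.Probability.RandomPlanarGeometry.HexSAWStripThresholdHyperbolicLower
import Mathlib.Analysis.Convex.Slope
import Mathlib.Analysis.Convex.SpecificFunctions.Basic
import HarnessLib

/-!
# The horizontal-bridge kernel of the honeycomb strip has a rank-one residue at the surface threshold `y_T`:
# `(y_T − y) · Σ_k (I(y)^k)_{ab} → ρ · u_a ℓ_b` — the renewal constant of critical strip bridges EXISTS (no Perron–Frobenius)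

Topic `Literature/Probability/RandomPlanarGeometry` (continues `HexSAWStripBridgeRenewal.lean` — the level matrices `HV.Imat T N y` of
irreducible horizontal Duminil-Copin–Hammond bridges of the width-`T` strip, their monotone limit `HV.Iinf T y`, irreducibility
`HV.reach_Imat_all`, the first-order bound `HV.exists_partialSum_pow_Iinf_le_div`; `HexSAWStripBridgeDecomposition.lean` — the curtain bound
`HV.stripGFy_beta_le_two_mul : B_{T,L} ≤ 2 F₁ D_N F₃`; `HexSAWStripThresholdHyperbolicLower.lean` — `a/(y_T − y) − C ≤ B_T(x_c; y)`) and
instantiates the abstract residue theorem of `Literature/Analysis/Matrix/NonnegMatrixFamilyResidue.lean`.  Sources of the SETTING: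
H. Duminil-Copin, A. Hammond, *Self-avoiding walk is sub-ballistic*, CMP 324 (2013) §2.2 (bridges, renewal points, irreducible bridges);
N. R. Beaton, M. Bousquet-Mélou, J. de Gier, H. Duminil-Copin, A. J. Guttmann, CMP 326 (2014), arXiv:1109.0358v5, §3.2 Corollary 8 (p. 12:
"The series (in `y`) `A_T(x_c, y)`, `B_T(x_c, y)` and `C_T(x_c, y)` have radius of convergence `y_T`"); E. Seneta, *Non-negative Matrices*
(1973), Chapter 6 (R-theory).  In print the strip series are rational (transfer matrices) and a residue at `y_T` would come from
Perron–Frobenius theory; none of the sources states the result below, and no spectral theory is used here.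

## What is proved (namespace `Literature.Probability.RandomPlanarGeometry.SAW.HV`; `x_c = hexCriticalFugacity`, `y_T = stripYT T`,
## `I(y) = Iinf T y` on the `2T` levels)

* §1 `wD_convex_comb`, `Imat_convex_comb`, ★ `Iinf_convexOn` — every entry of `I(y)` is CONVEX in `y` on `[1, y_T)` (a supremum of
  polynomials with non-negative coefficients); `Iinf_mono_y`; `summable_pow_Iinf_apply`; the upper bound `exists_neumannSum_Iinf_le_div`
  (`Σ_k (I(y)^k)_{ab} ≤ C/(y_T − y)`, from the tree); `Iinf_irred` (irreducible at every `y ∈ [1, y_T)`).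
* §2 `hBridgeSumN_le_tsum : D_N(y) ≤ x_c y (K + Σ_{ab} Σ_k (I(y)^k)_{ab})` and ★ `exists_stripByLim_le_mul_sum_tsum` (`T ≥ 2`):
  `B_T(x_c; y) ≤ A · (K + Σ_{ab} Σ_k (I(y)^k)_{ab})` on `[1, y_T)` (curtain bound + uniform bounds on the free ends).
* §3 ★ `exists_div_le_sum_tsum` (`T ≥ 2`): from the hyperbolic lower bound on `B_T(x_c; ·)`, `c/(y_T − y) ≤ Σ_{ab} Σ_k (I(y)^k)_{ab}` on a
  left neighbourhood `[y₁, y_T)`.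
* §4 ★★ `exists_neumannFamily_Iinf` (`T ≥ 2`): on some `[y₁, y_T)` the kernel is a `NeumannFamily` (the lower bound is spread to every
  entry by irreducibility, `exists_pos_mul_neumannSum_le`).
* §5 ★★★ `exists_tendsto_bridgeKernel_residue` (`T ≥ 2`, UNCONDITIONAL): there are the limit kernel `I_T = lim_{y↑y_T} I(y)`, positive
  level vectors `u` (`I_T u = u`) and `ℓ` (`ℓ I_T = ℓ`), and `ρ > 0` with `(y_T − y) · Σ_k (I(y)^k)_{ab} → ρ · u_a ℓ_b` as `y ↑ y_T`, for
  all levels `a, b` — an exact simple pole with RANK-ONE residue: the entrance and exit levels of a critical strip bridge decouple, with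
  laws `∝ u` and `∝ ℓ`.  (`…_of_hyperbolicLower` is the same with the lower bound as a binder.)
* §6 `hKernel T a b y = sup_N Dab T N a b y` — the generating function `D_{ab}(y)` of ALL standard horizontal bridges from level `a` to
  level `b`; ★ `hKernel_eq_tsum_succ : D_{ab}(y) = Σ_{k≥1} (I(y)^k)_{ab}` on `[1, y_T)` (free concatenation of irreducible bridges is
  exact in the limit of the tree's truncations `D^{(k)}_N ≤ I_N^k ≤ D^{(k)}_{kN}`); ★★★ `exists_tendsto_hKernel_residue` (`T ≥ 2`):
  `(y_T − y) · D_{ab}(y) → ρ · u_a ℓ_b` with the same `u`, `ℓ`, `ρ`; ★★ `exists_tendsto_hKernel_ratio`: `D_{ab}(y)/D_{cd}(y) → u_a ℓ_b/(u_c ℓ_d)`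
  — the entrance and exit levels of a critical strip bridge decouple; ★★ `exists_tendsto_exitLaw`: `D_{ab}(y)/Σ_{b'} D_{ab'}(y) → ℓ_b/Σℓ`.

Label: LANE THEOREM (own result of lane «pcv-sawmu», a-p2 g18, 2026-08-25): the renewal constant of the strip's bridge kernel exists,
proved without Perron–Frobenius or rationality.  NOT claimed: the residue of `B_T(x_c; ·)` itself (the curtain decomposition is only an
injection), the width `T = 1`, the coefficientwise renewal theorem, `T`-uniformity, any closed form of `u`, `ℓ`, `ρ`.
-/

noncomputable section

open Finset Filter Topology Matrix Literature.Probability.LatticeModels Literature.Probability.Percolation Literature.Analysis.Matrix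

namespace Literature.Probability.RandomPlanarGeometry.SAW

namespace HV

variable {T : ℕ}

/-! ### §1 Convexity and monotonicity of the limit kernel `I(y) = Iinf T y` in `y` -/

/-- The weight `wD T y l = x_c^{|l|−1} y^{#top}` is convex in `y ≥ 0` (a monomial with a non-negative coefficient).
[cite: DuminilCopinHammond2013, §2.2 (bridges of the strip); lane plumbing] -/
theorem wD_convex_comb (l : List HV) {y z θ : ℝ} (hy : 0 ≤ y) (hz : 0 ≤ z) (hθ : 0 ≤ θ) (hθ1 : θ ≤ 1) :
    wD T (θ * y + (1 - θ) * z) l ≤ θ * wD T y l + (1 - θ) * wD T z l := by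
  unfold wD
  have hx : 0 ≤ hexCriticalFugacity ^ (l.length - 1) := pow_nonneg hexCriticalFugacity_pos_lt_one.1.le _
  have hpow : (θ * y + (1 - θ) * z) ^ topCnt T l.tail ≤ θ * y ^ topCnt T l.tail + (1 - θ) * z ^ topCnt T l.tail := by
    have h := (convexOn_pow (topCnt T l.tail)).2 (Set.mem_Ici.2 hy) (Set.mem_Ici.2 hz) hθ (sub_nonneg.2 hθ1) (add_sub_cancel θ 1)
    simpa only [smul_eq_mul] using h
  calc hexCriticalFugacity ^ (l.length - 1) * (θ * y + (1 - θ) * z) ^ topCnt T l.tail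
      ≤ hexCriticalFugacity ^ (l.length - 1) * (θ * y ^ topCnt T l.tail + (1 - θ) * z ^ topCnt T l.tail) :=
        mul_le_mul_of_nonneg_left hpow hx
    _ = _ := by ring

/-- `Imat T N y a b` is convex in `y ≥ 0`. [cite: DuminilCopinHammond2013, §2.2; lane plumbing] -/
theorem Imat_convex_comb (N : ℕ) (a b : Fin (2 * T)) {y z θ : ℝ} (hy : 0 ≤ y) (hz : 0 ≤ z) (hθ : 0 ≤ θ) (hθ1 : θ ≤ 1) :
    Imat T N (θ * y + (1 - θ) * z) a b ≤ θ * Imat T N y a b + (1 - θ) * Imat T N z a b := by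
  simp only [Imat, Dk, Finset.mul_sum, ← Finset.sum_add_distrib]
  exact Finset.sum_le_sum fun l _ => wD_convex_comb l hy hz hθ hθ1

/-- `I(y)_{ab} = Iinf T y a b` is non-decreasing in `y` on `[1, y_T)`. [cite: DuminilCopinHammond2013, §2.2; lane plumbing] -/
theorem Iinf_mono_y (hT : 1 ≤ T) {y y' : ℝ} (hy : y ∈ Set.Ico 1 (stripYT T)) (hy' : y' ∈ Set.Ico 1 (stripYT T)) (hyy : y ≤ y')
    (a b : Fin (2 * T)) : Iinf T y a b ≤ Iinf T y' a b :=
  ciSup_le fun N => (Imat_mono_y (sub_threshold_of_mem_Ico hT hy).2.1 hyy a b).trans (Imat_le_Iinf hT hy' N a b)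

/-- `I(y)_{ab}` is convex in `y` on `[1, y_T)` (a supremum of polynomials with non-negative coefficients).
[cite: DuminilCopinHammond2013, §2.2; lane plumbing] -/
theorem Iinf_convexOn (hT : 1 ≤ T) (a b : Fin (2 * T)) : ConvexOn ℝ (Set.Ico 1 (stripYT T)) fun y => Iinf T y a b := by
  refine ⟨convex_Ico _ _, fun y hy z hz θ η hθ hη hθη => ?_⟩
  have hy0 : 0 ≤ y := zero_le_one.trans hy.1
  have hz0 : 0 ≤ z := zero_le_one.trans hz.1
  simp only [smul_eq_mul]
  refine ciSup_le fun N => ?_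
  have hη' : η = 1 - θ := by linarith
  subst hη'
  calc Imat T N (θ * y + (1 - θ) * z) a b ≤ θ * Imat T N y a b + (1 - θ) * Imat T N z a b :=
        Imat_convex_comb N a b hy0 hz0 hθ (by linarith)
    _ ≤ θ * Iinf T y a b + (1 - θ) * Iinf T z a b :=
        add_le_add (mul_le_mul_of_nonneg_left (Imat_le_Iinf hT hy N a b) hθ)
          (mul_le_mul_of_nonneg_left (Imat_le_Iinf hT hz N a b) hη)

/-- Every entry series `Σ_k (I(y)^k)_{ab}` is summable below the threshold. [cite: Seneta1973, §6.1; lane plumbing] (`private` — statement-twin of `HV.summable_pow_Iinf` in `HexSAWStripThresholdPointwise.lean`, which this file does not import.) -/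
private theorem summable_pow_Iinf_apply (hT : 1 ≤ T) {y : ℝ} (hy : y ∈ Set.Ico 1 (stripYT T)) (a b : Fin (2 * T)) :
    Summable fun k => (Iinf T y ^ k) a b := by
  obtain ⟨B, hB⟩ := exists_partialSum_pow_Iinf_le hT hy
  refine summable_of_sum_range_le (fun k => nonnegMat_pow_apply_nonneg (Iinf_nonneg hT hy) k a b) (c := B) fun n => ?_
  rw [← Matrix.sum_apply]
  exact hB n a b

/-- The first-order UPPER bound of the Neumann sum of the limit kernel: `Σ_k (I(y)^k)_{ab} ≤ C/(y_T − y)` on `[1, y_T)`.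
[cite: Seneta1973, §6.1–§6.2; lane (P), `HexSAWStripBridgeRenewal`] -/
theorem exists_neumannSum_Iinf_le_div (hT : 1 ≤ T) :
    ∃ C : ℝ, ∀ y ∈ Set.Ico (1 : ℝ) (stripYT T), ∀ a b : Fin (2 * T), ∑' k, (Iinf T y ^ k) a b ≤ C / (stripYT T - y) := by
  obtain ⟨C, hC⟩ := exists_partialSum_pow_Iinf_le_div hT
  refine ⟨C, fun y hy a b => ?_⟩
  refine (summable_pow_Iinf_apply hT hy a b).tsum_le_of_sum_range_le fun n => ?_
  rw [← Matrix.sum_apply]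
  exact hC y hy n a b

/-- The kernel is irreducible at every `y ∈ [1, y_T)` (it dominates `I_2(1)`, irreducible by `reach_Imat_all`).
[cite: DuminilCopinHammond2013, §2.2; lane plumbing] -/
theorem Iinf_irred (hT : 1 ≤ T) {y : ℝ} (hy : y ∈ Set.Ico 1 (stripYT T)) (a b : Fin (2 * T)) : ∃ j, 0 < (Iinf T y ^ j) a b := by
  obtain ⟨j, hj⟩ := reach_Imat_all hT (N := 2) le_rfl a b
  refine ⟨j, hj.trans_le (nonnegMat_pow_apply_mono (fun a b => (Imat_Dmat_nonneg (N := 2) (k := 1) zero_le_one a b).1)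
    (fun a b => ?_) j a b)⟩
  exact (Imat_mono_y zero_le_one hy.1 a b).trans (Imat_le_Iinf hT hy 2 a b)

/-! ### §2 The truncated horizontal-bridge series below the Neumann sum of the limit kernel -/

/-- `D_N(y) ≤ x_c y · (K + Σ_{ab} Σ_k (I(y)^k)_{ab})` for `y ∈ [1, y_T)`, with `K = #stripChains T 0`
(the one-vertex bridges). [cite: DuminilCopinHammond2013, §2.2 (decomposition into irreducible bridges); lane plumbing] -/
theorem hBridgeSumN_le_tsum (hT : 1 ≤ T) {N : ℕ} {y : ℝ} (hy : y ∈ Set.Ico 1 (stripYT T)) :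
    hBridgeSumN T N y ≤ hexCriticalFugacity * y *
      (((stripChains T 0).card : ℝ) + ∑ ab : Fin (2 * T) × Fin (2 * T), ∑' k, (Iinf T y ^ k) ab.1 ab.2) := by
  classical
  have hx := hexCriticalFugacity_pos_lt_one
  have hy1 : 1 ≤ y := hy.1
  have hy0 : 0 ≤ y := by linarith
  -- each level class is below the Neumann sum
  have hDab : ∀ ab : Fin (2 * T) × Fin (2 * T), Dab T N (ab.1 : ℕ) (ab.2 : ℕ) y ≤ ∑' k, (Iinf T y ^ k) ab.1 ab.2 := by
    intro ab
    calc Dab T N (ab.1 : ℕ) (ab.2 : ℕ) y ≤ ∑ k ∈ range N, Dk T N (k + 1) (ab.1 : ℕ) (ab.2 : ℕ) y := Dab_le_sum_Dk hy0 _ _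
      _ ≤ ∑ k ∈ range N, (Iinf T y ^ (k + 1)) ab.1 ab.2 := by
          refine sum_le_sum fun k _ => ?_
          calc Dk T N (k + 1) (ab.1 : ℕ) (ab.2 : ℕ) y = Dmat T N (k + 1) y ab.1 ab.2 := rfl
            _ ≤ (Imat T N y ^ (k + 1)) ab.1 ab.2 := Dmat_le_pow hy0 (k + 1) (by omega) _ _
            _ ≤ (Iinf T y ^ (k + 1)) ab.1 ab.2 := nonnegMat_pow_apply_mono
                (fun a b => (Imat_Dmat_nonneg (N := N) (k := 1) hy0 a b).1) (fun a b => Imat_le_Iinf hT hy N a b) _ _ _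
      _ ≤ ∑ k ∈ range (N + 1), (Iinf T y ^ k) ab.1 ab.2 := by
          rw [sum_range_succ']
          have : 0 ≤ (Iinf T y ^ 0) ab.1 ab.2 := by rw [pow_zero, Matrix.one_apply]; split_ifs <;> norm_num
          linarith
      _ ≤ ∑' k, (Iinf T y ^ k) ab.1 ab.2 :=
          (summable_pow_Iinf_apply hT hy _ _).sum_le_tsum _ fun k _ => nonnegMat_pow_apply_nonneg (Iinf_nonneg hT hy) k _ _
  have haux := hBridgeSumN_le_aux (T := T) (N := N) hy1
  refine haux.trans (mul_le_mul_of_nonneg_left ?_ (mul_nonneg hx.1.le hy0))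
  exact add_le_add le_rfl (sum_le_sum fun ab _ => hDab ab)

/-- `Σ_{ab} Σ_k (I(y)^k)_{ab} ≥ 0` (plumbing). [cite: Seneta1973, §6.1] -/
theorem sum_tsum_pow_Iinf_nonneg (hT : 1 ≤ T) {y : ℝ} (hy : y ∈ Set.Ico 1 (stripYT T)) :
    0 ≤ ∑ ab : Fin (2 * T) × Fin (2 * T), ∑' k, (Iinf T y ^ k) ab.1 ab.2 :=
  sum_nonneg fun _ _ => tsum_nonneg fun k => nonnegMat_pow_apply_nonneg (Iinf_nonneg hT hy) k _ _

/-- **The bridge series below the Neumann sums of the kernel** (`T ≥ 2`): there is `A ≥ 0` with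
`B_T(x_c; y) ≤ A · (K + Σ_{ab} Σ_k (I(y)^k)_{ab})` for every `y ∈ [1, y_T)` (curtain decomposition `B ≤ 2 F₁ D_N F₃` of
`HexSAWStripBridgeDecomposition`, uniform bounds on the free ends, and `hBridgeSumN_le_tsum`).
[cite: DuminilCopinHammond2013, §2.2; BeatonBousquetMelouDeGierDuminilCopinGuttmann2014, §3.2 (B_T); lane plumbing] -/
theorem exists_stripByLim_le_mul_sum_tsum (hT : 2 ≤ T) :
    ∃ A : ℝ, 0 ≤ A ∧ ∀ y ∈ Set.Ico (1 : ℝ) (stripYT T),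
      stripByLim T y ≤ A * (((stripChains T 0).card : ℝ) + ∑ ab : Fin (2 * T) × Fin (2 * T), ∑' k, (Iinf T y ^ k) ab.1 ab.2) := by
  have hT1 : 1 ≤ T := by omega
  have hx := hexCriticalFugacity_pos_lt_one
  obtain ⟨C₁, hC₁⟩ := exists_topFreeSumN_le hT1
  obtain ⟨C₃, hC₃⟩ := exists_botFreeSumN_le hT (one_lt_stripYT hT1).le (hexCriticalFugacity_mul_stripNu_pred_stripYT_lt_one hT)
  have hC1' : 0 ≤ C₁ := (topFreeSumN_nonneg T 0).trans (hC₁ 0)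
  have hyT0 : 0 ≤ stripYT T := (one_lt_stripYT hT1).le.trans' zero_le_one
  have hC3' : 0 ≤ C₃ := (botFreeSumN_nonneg_mono T 0 hyT0 le_rfl).1.trans (hC₃ 0)
  refine ⟨2 * (C₁ * C₃) * (hexCriticalFugacity * stripYT T),
    mul_nonneg (mul_nonneg zero_le_two (mul_nonneg hC1' hC3')) (mul_nonneg hx.1.le hyT0), fun y hy => ?_⟩
  have hy1 : 1 ≤ y := hy.1
  have hy0 : 0 ≤ y := by linarith
  set SS : ℝ := ((stripChains T 0).card : ℝ) + ∑ ab : Fin (2 * T) × Fin (2 * T), ∑' k, (Iinf T y ^ k) ab.1 ab.2 with hSS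
  have hSS0 : 0 ≤ SS := add_nonneg (by positivity) (sum_tsum_pow_Iinf_nonneg hT1 hy)
  have hbox : ∀ L, stripGFy T L (IsBetaDart T) y ≤ 2 * (C₁ * C₃) * (hexCriticalFugacity * stripYT T) * SS := by
    intro L
    set N := (stripV T L).card
    have h1 := stripGFy_beta_le_two_mul hT1 hy0 (N := N) (L := L) (by omega)
    have hD := hBridgeSumN_le_tsum hT1 (N := N) hy
    have hD0 := hBridgeSumN_nonneg T N hy0
    have hF1 := hC₁ N
    have hF10 := topFreeSumN_nonneg T N
    obtain ⟨hF30, hF3m⟩ := botFreeSumN_nonneg_mono T N hy0 hy.2.le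
    have hF3 := hF3m.trans (hC₃ N)
    have hD' : hBridgeSumN T N y ≤ hexCriticalFugacity * stripYT T * SS :=
      hD.trans (mul_le_mul_of_nonneg_right (mul_le_mul_of_nonneg_left hy.2.le hx.1.le) hSS0)
    calc stripGFy T L (IsBetaDart T) y ≤ 2 * (topFreeSumN T N * hBridgeSumN T N y * botFreeSumN T N y) := h1
      _ ≤ 2 * (C₁ * (hexCriticalFugacity * stripYT T * SS) * C₃) := by
          have h2 : topFreeSumN T N * hBridgeSumN T N y ≤ C₁ * (hexCriticalFugacity * stripYT T * SS) :=
            mul_le_mul hF1 hD' hD0 hC1'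
          have h3 := mul_le_mul h2 hF3 hF30 ((mul_nonneg hF10 hD0).trans h2)
          linarith
      _ = 2 * (C₁ * C₃) * (hexCriticalFugacity * stripYT T) * SS := by ring
  exact ciSup_le hbox

/-! ### §3 The lower first-order bound on the sum of the Neumann entries near `y_T` -/

/-- From a lower hyperbolic bound on the bridge series (`a/(y_T − y) − C ≤ B_T(x_c; y)`, the tree's
`HexSAWStripThresholdHyperbolicLower`) to a lower first-order bound on `Σ_{ab} Σ_k (I(y)^k)_{ab}` on a left neighbourhood
`[y₁, y_T)` of the threshold (`T ≥ 2`). [cite: BeatonBousquetMelouDeGierDuminilCopinGuttmann2014, Corollary 8; lane plumbing] -/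
theorem exists_div_le_sum_tsum (hT : 2 ≤ T)
    (hHyp : ∃ a : ℝ, 0 < a ∧ ∃ C : ℝ, ∀ y : ℝ, 0 ≤ y → y < stripYT T → a / (stripYT T - y) - C ≤ stripByLim T y) :
    ∃ y₁ ∈ Set.Ico (1 : ℝ) (stripYT T), ∃ c : ℝ, 0 < c ∧ ∀ y ∈ Set.Ico y₁ (stripYT T),
      c / (stripYT T - y) ≤ ∑ ab : Fin (2 * T) × Fin (2 * T), ∑' k, (Iinf T y ^ k) ab.1 ab.2 := by
  have hT1 : 1 ≤ T := by omega
  have hyT := one_lt_stripYT hT1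
  obtain ⟨a, ha, C, hC⟩ := hHyp
  obtain ⟨A, hA0, hA⟩ := exists_stripByLim_le_mul_sum_tsum hT
  set A' : ℝ := A + 1 with hA'
  have hA'0 : 0 < A' := by linarith
  set K : ℝ := ((stripChains T 0).card : ℝ) with hK
  have hK0 : 0 ≤ K := by positivity
  set δ : ℝ := a / (2 * (|C| + A' * K + 1)) with hδ
  have hden : 0 < |C| + A' * K + 1 := by positivity
  have hδ0 : 0 < δ := by positivity
  refine ⟨max 1 (stripYT T - δ), ⟨le_max_left _ _, max_lt hyT (by linarith)⟩, a / (2 * A'), by positivity, fun y hy => ?_⟩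
  have hy1 : 1 ≤ y := (le_max_left _ _).trans hy.1
  have hyδ : stripYT T - y ≤ δ := by linarith [(le_max_right _ _).trans hy.1]
  have hmem : y ∈ Set.Ico (1 : ℝ) (stripYT T) := ⟨hy1, hy.2⟩
  set t : ℝ := stripYT T - y with ht
  have ht0 : 0 < t := sub_pos.2 hy.2
  set S : ℝ := ∑ ab : Fin (2 * T) × Fin (2 * T), ∑' k, (Iinf T y ^ k) ab.1 ab.2 with hS
  have hS0 : 0 ≤ S := sum_tsum_pow_Iinf_nonneg hT1 hmem
  -- the two bounds
  have hlow : a / t - C ≤ A' * (K + S) := by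
    have h1 := hC y (by linarith) hy.2
    have h2 := hA y hmem
    have h3 : A * (K + S) ≤ A' * (K + S) := mul_le_mul_of_nonneg_right (by linarith) (add_nonneg hK0 hS0)
    linarith
  -- `u = a/(2t) ≥ |C| + A'K + 1`
  set u : ℝ := a / (2 * t) with hu
  have hau : a / t = 2 * u := by rw [hu]; field_simp
  have hu1 : |C| + A' * K + 1 ≤ u := by
    rw [hu, le_div_iff₀ (by positivity)]
    calc (|C| + A' * K + 1) * (2 * t) ≤ (|C| + A' * K + 1) * (2 * δ) := by
          exact mul_le_mul_of_nonneg_left (by linarith) hden.le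
      _ = a := by rw [hδ]; field_simp
  have hCabs : C ≤ |C| := le_abs_self C
  -- conclude `A' S ≥ u`
  have hAS : u ≤ A' * S := by nlinarith [mul_nonneg hA'0.le hK0]
  have hgoal : a / (2 * A') / t = u / A' := by rw [hu]; field_simp
  rw [hgoal, div_le_iff₀ hA'0]
  calc u ≤ A' * S := hAS
    _ = S * A' := mul_comm _ _

/-! ### §4 The kernel is a `NeumannFamily` on a left neighbourhood of the threshold -/

/-- **The kernel `y ↦ I(y)` of the strip satisfies the hypotheses of the abstract residue theorem** on some `[y₁, y_T)`
(`T ≥ 2`), given the lower hyperbolic bound on `B_T(x_c; ·)`: non-negative, non-decreasing, convex, irreducible, summable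
Neumann series, and `c/(y_T − y) ≤ Σ_k (I(y)^k)_{ab} ≤ C/(y_T − y)` for all entries.
[cite: Seneta1973, Chapter 6; DuminilCopinHammond2013, §2.2; BeatonBousquetMelouDeGierDuminilCopinGuttmann2014, Corollary 8; lane] -/
theorem exists_neumannFamily_Iinf (hT : 2 ≤ T)
    (hHyp : ∃ a : ℝ, 0 < a ∧ ∃ C : ℝ, ∀ y : ℝ, 0 ≤ y → y < stripYT T → a / (stripYT T - y) - C ≤ stripByLim T y) :
    ∃ y₁ ∈ Set.Ico (1 : ℝ) (stripYT T), ∃ c C : ℝ, NeumannFamily (fun y => Iinf T y) y₁ (stripYT T) c C := by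
  classical
  have hT1 : 1 ≤ T := by omega
  obtain ⟨y₁, hy₁, c₀, hc₀, hlow⟩ := exists_div_le_sum_tsum hT hHyp
  obtain ⟨Cup, hCup⟩ := exists_neumannSum_Iinf_le_div hT1
  haveI : Nonempty (Fin (2 * T)) := ⟨⟨0, by omega⟩⟩
  obtain ⟨p, hp, hspread⟩ := exists_pos_mul_neumannSum_le (Iinf_nonneg hT1 hy₁) (Iinf_irred hT1 hy₁)
  have hsub : ∀ {y : ℝ}, y ∈ Set.Ico y₁ (stripYT T) → y ∈ Set.Ico (1 : ℝ) (stripYT T) := fun hy => ⟨hy₁.1.trans hy.1, hy.2⟩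
  set F : ℝ := (Fintype.card (Fin (2 * T) × Fin (2 * T)) : ℝ) with hF
  have hF0 : 0 < F := by rw [hF]; exact_mod_cast Fintype.card_pos
  refine ⟨y₁, hy₁, p * c₀ / F, Cup, ?_⟩
  exact
    { lt := hy₁.2
      pos := by positivity
      nonneg := fun y hy a b => Iinf_nonneg hT1 (hsub hy) a b
      mono := fun y y' hy hy' hyy a b => Iinf_mono_y hT1 (hsub hy) (hsub hy') hyy a b
      convex := fun a b => (Iinf_convexOn hT1 a b).subset (Set.Ico_subset_Ico hy₁.1 le_rfl) (convex_Ico _ _)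
      irred := Iinf_irred hT1 hy₁
      summable := fun y hy a b => summable_pow_Iinf_apply hT1 (hsub hy) a b
      lower := fun y hy a b => by
        -- spread the bound on the sum of the entries to the entry `(a, b)`
        have hsp := hspread (Iinf T y) (fun a b => Iinf_mono_y hT1 hy₁ (hsub hy) hy.1 a b)
          (fun a b => summable_pow_Iinf_apply hT1 (hsub hy) a b)
        have h1 : p * ∑ cd : Fin (2 * T) × Fin (2 * T), ∑' k, (Iinf T y ^ k) cd.1 cd.2 ≤ F * neumannSum (Iinf T y) a b := by
          rw [Finset.mul_sum]
          calc ∑ cd : Fin (2 * T) × Fin (2 * T), p * ∑' k, (Iinf T y ^ k) cd.1 cd.2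
              ≤ ∑ _cd : Fin (2 * T) × Fin (2 * T), neumannSum (Iinf T y) a b := sum_le_sum fun cd _ => hsp cd.1 cd.2 a b
            _ = F * neumannSum (Iinf T y) a b := by rw [sum_const, nsmul_eq_mul, hF, Finset.card_univ]
        have h2 := hlow y hy
        have hpos : 0 < stripYT T - y := sub_pos.2 hy.2
        rw [div_div, div_le_iff₀ (mul_pos hF0 hpos)] at *
        rw [div_le_iff₀ hpos] at h2
        nlinarith [h1, h2, hp.le]
      upper := fun y hy a b => hCup y (hsub hy) a b }

/-! ### §5 The residue of the horizontal-bridge kernel at the threshold -/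

/-- ★★★ **THE RESIDUE OF THE BRIDGE KERNEL (conditional form).** For `T ≥ 2`, given the lower hyperbolic bound on
`B_T(x_c; ·)`, there are a limit kernel `I_T = lim_{y↑y_T} I(y)` (entrywise), positive vectors `u`, `ℓ` on the `2T` levels with
`I_T u = u`, `ℓ I_T = ℓ`, and a constant `ρ > 0` such that for all levels `a, b`:
`(y_T − y) · Σ_k (I(y)^k)_{ab} ⟶ ρ · u_a ℓ_b` as `y ↑ y_T`.  The two-point kernel of critical horizontal bridges of the strip by
entrance/exit level has an exact simple pole at `y_T` with a RANK-ONE residue: entrance and exit levels decouple in the limit.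
[cite: DuminilCopinHammond2013, §2.2 (renewal structure of bridges); Seneta1973, Chapter 6 (R-theory); BeatonBousquetMelouDeGierDuminilCopinGuttmann2014, Corollary 8 (the threshold y_T); lane «pcv-sawmu», a-p2 g18 — own result, Perron–Frobenius-free] -/
theorem exists_tendsto_bridgeKernel_residue_of_hyperbolicLower (hT : 2 ≤ T)
    (hHyp : ∃ a : ℝ, 0 < a ∧ ∃ C : ℝ, ∀ y : ℝ, 0 ≤ y → y < stripYT T → a / (stripYT T - y) - C ≤ stripByLim T y) :
    ∃ (IT : Matrix (Fin (2 * T)) (Fin (2 * T)) ℝ) (u ℓ : Fin (2 * T) → ℝ) (ρ : ℝ),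
      (∀ a b, Tendsto (fun y => Iinf T y a b) (𝓝[<] stripYT T) (𝓝 (IT a b))) ∧
      (∀ a, 0 < u a) ∧ (∀ b, 0 < ℓ b) ∧ IT *ᵥ u = u ∧ ℓ ᵥ* IT = ℓ ∧ 0 < ρ ∧
      ∀ a b, Tendsto (fun y => (stripYT T - y) * ∑' k, (Iinf T y ^ k) a b) (𝓝[<] stripYT T) (𝓝 (ρ * (u a * ℓ b))) := by
  obtain ⟨y₁, hy₁, c, C, hF⟩ := exists_neumannFamily_Iinf hT hHyp
  haveI : Nonempty (Fin (2 * T)) := ⟨⟨0, by omega⟩⟩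
  obtain ⟨u, ℓ, hu0, hℓ0, hu, hℓ, hpos, hT'⟩ := hF.exists_tendsto_mul_neumannSum_apply
  refine ⟨hF.Ilim, u, ℓ, 1 / (ℓ ⬝ᵥ (hF.J *ᵥ u)), hF.tendsto_apply_Ilim, hu0, hℓ0, hu, hℓ, one_div_pos.2 hpos, fun a b => ?_⟩
  have h := hT' a b
  convert h using 2
  simp only [neumannSum]
  ring

/-- ★★★ **THE RESIDUE OF THE BRIDGE KERNEL AT THE THRESHOLD (unconditional, every `T ≥ 2`).** There are the limit kernel
`I_T = lim_{y↑y_T} I(y)`, positive vectors `u` (`I_T u = u`), `ℓ` (`ℓ I_T = ℓ`) on the `2T` levels and `ρ > 0` such that for all levels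
`a, b`: `(y_T − y) · Σ_k (I(y)^k)_{ab} ⟶ ρ · u_a ℓ_b` as `y ↑ y_T`.  The lower bound binder of
`exists_tendsto_bridgeKernel_residue_of_hyperbolicLower` is the tree's `exists_div_sub_le_stripByLim`.
[cite: DuminilCopinHammond2013, §2.2; Seneta1973, Chapter 6; BeatonBousquetMelouDeGierDuminilCopinGuttmann2014, Corollary 8 (arXiv v5 p. 12); lane «pcv-sawmu», a-p2 g18 — own result, Perron–Frobenius-free] -/
theorem exists_tendsto_bridgeKernel_residue (hT : 2 ≤ T) :
    ∃ (IT : Matrix (Fin (2 * T)) (Fin (2 * T)) ℝ) (u ℓ : Fin (2 * T) → ℝ) (ρ : ℝ),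
      (∀ a b, Tendsto (fun y => Iinf T y a b) (𝓝[<] stripYT T) (𝓝 (IT a b))) ∧
      (∀ a, 0 < u a) ∧ (∀ b, 0 < ℓ b) ∧ IT *ᵥ u = u ∧ ℓ ᵥ* IT = ℓ ∧ 0 < ρ ∧
      ∀ a b, Tendsto (fun y => (stripYT T - y) * ∑' k, (Iinf T y ^ k) a b) (𝓝[<] stripYT T) (𝓝 (ρ * (u a * ℓ b))) :=
  exists_tendsto_bridgeKernel_residue_of_hyperbolicLower hT (exists_div_sub_le_stripByLim (by omega))

/-! ### §6 The same residue for the generating functions of ALL horizontal bridges between two levels -/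

/-- `D_{ab}(y) := sup_N Dab T N a b y`: the total weight `Σ x_c^{|h|−1} y^{#top(h.tail)}` of the standard horizontal bridges of `S_T`
from level `a` to level `b` (any number of irreducible pieces, any length).
[cite: DuminilCopinHammond2013, §2.2 (bridges of the strip decompose uniquely into irreducible bridges)] -/
def hKernel (T : ℕ) (a b : Fin (2 * T)) (y : ℝ) : ℝ := ⨆ N : ℕ, Dab T N (a : ℕ) (b : ℕ) y

/-- `Dk` is non-decreasing in the vertex bound. [cite: DuminilCopinHammond2013, §2.2; lane plumbing] -/
theorem Dk_mono_M {M M' : ℕ} (h : M ≤ M') {y : ℝ} (hy : 0 ≤ y) (k : ℕ) (a b : ℤ) : Dk T M k a b y ≤ Dk T M' k a b y :=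
  sum_le_sum_of_subset_of_nonneg (HBk_mono h k a b) fun _ _ _ => wD_nonneg T hy _

/-- `Dab_N(a,b)(y) ≤ Σ_{k ≥ 1} (I(y)^k)_{ab}` below the threshold. [cite: DuminilCopinHammond2013, §2.2; Seneta1973, §6.1; lane plumbing] -/
theorem Dab_le_tsum_succ (hT : 1 ≤ T) {N : ℕ} {y : ℝ} (hy : y ∈ Set.Ico 1 (stripYT T)) (a b : Fin (2 * T)) :
    Dab T N (a : ℕ) (b : ℕ) y ≤ ∑' k, (Iinf T y ^ (k + 1)) a b := by
  have hy0 : 0 ≤ y := zero_le_one.trans hy.1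
  have hsum1 : Summable fun k => (Iinf T y ^ (k + 1)) a b := (summable_nat_add_iff (f := fun k => (Iinf T y ^ k) a b) 1).2 (summable_pow_Iinf_apply hT hy a b)
  calc Dab T N (a : ℕ) (b : ℕ) y ≤ ∑ k ∈ range N, Dk T N (k + 1) (a : ℕ) (b : ℕ) y := Dab_le_sum_Dk hy0 _ _
    _ ≤ ∑ k ∈ range N, (Iinf T y ^ (k + 1)) a b := by
        refine sum_le_sum fun k _ => ?_
        calc Dk T N (k + 1) (a : ℕ) (b : ℕ) y = Dmat T N (k + 1) y a b := rfl
          _ ≤ (Imat T N y ^ (k + 1)) a b := Dmat_le_pow hy0 (k + 1) (by omega) _ _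
          _ ≤ (Iinf T y ^ (k + 1)) a b := nonnegMat_pow_apply_mono
              (fun a b => (Imat_Dmat_nonneg (N := N) (k := 1) hy0 a b).1) (fun a b => Imat_le_Iinf hT hy N a b) _ _ _
    _ ≤ ∑' k, (Iinf T y ^ (k + 1)) a b :=
        hsum1.sum_le_tsum _ fun k _ => nonnegMat_pow_apply_nonneg (Iinf_nonneg hT hy) (k + 1) a b

/-- `BddAbove` of `N ↦ Dab_N(a,b)(y)` below the threshold. [cite: DuminilCopinHammond2013, §2.2; lane plumbing] -/
theorem bddAbove_Dab (hT : 1 ≤ T) {y : ℝ} (hy : y ∈ Set.Ico 1 (stripYT T)) (a b : Fin (2 * T)) :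
    BddAbove (Set.range fun N : ℕ => Dab T N (a : ℕ) (b : ℕ) y) :=
  ⟨_, by rintro _ ⟨N, rfl⟩; exact Dab_le_tsum_succ hT hy a b⟩

/-- ★ **`D_{ab}(y) = Σ_{k ≥ 1} (I(y)^k)_{ab}`** for `y ∈ [1, y_T)`: all horizontal bridges from `a` to `b` are exactly the free
concatenations of irreducible ones (the truncations `D^{(k)}_N ≤ I_N^k ≤ D^{(k)}_{kN}` of the tree squeeze in the limit).
[cite: DuminilCopinHammond2013, §2.2 (unique decomposition into irreducible bridges; Kesten 1963); Seneta1973, §6.1] -/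
theorem hKernel_eq_tsum_succ (hT : 1 ≤ T) {y : ℝ} (hy : y ∈ Set.Ico 1 (stripYT T)) (a b : Fin (2 * T)) :
    hKernel T a b y = ∑' k, (Iinf T y ^ (k + 1)) a b := by
  have hy0 : 0 ≤ y := zero_le_one.trans hy.1
  refine le_antisymm (ciSup_le fun N => Dab_le_tsum_succ hT hy a b) ?_
  have hsum1 : Summable fun k => (Iinf T y ^ (k + 1)) a b := (summable_nat_add_iff (f := fun k => (Iinf T y ^ k) a b) 1).2 (summable_pow_Iinf_apply hT hy a b)
  -- every finite sum `Σ_{k<n} (I(y)^{k+1})_{ab}` is below `D_{ab}(y)`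
  refine hsum1.tsum_le_of_sum_range_le fun n => ?_
  have hfin : ∀ N, ∑ k ∈ range n, (Imat T N y ^ (k + 1)) a b ≤ hKernel T a b y := fun N => by
    calc ∑ k ∈ range n, (Imat T N y ^ (k + 1)) a b ≤ ∑ k ∈ range n, Dk T (n * N) (k + 1) (a : ℕ) (b : ℕ) y := by
          refine sum_le_sum fun k hk => ?_
          rw [mem_range] at hk
          calc (Imat T N y ^ (k + 1)) a b ≤ Dmat T ((k + 1) * N) (k + 1) y a b := pow_Imat_le_Dmat hy0 (k + 1) (by omega) a b
            _ ≤ Dk T (n * N) (k + 1) (a : ℕ) (b : ℕ) y := Dk_mono_M (Nat.mul_le_mul_right N (by omega)) hy0 _ _ _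
      _ ≤ Dab T (n * N) (a : ℕ) (b : ℕ) y := sum_Dk_le_Dab hy0 n _ _
      _ ≤ hKernel T a b y := le_ciSup (bddAbove_Dab hT hy a b) (n * N)
  have hlim : Tendsto (fun N => ∑ k ∈ range n, (Imat T N y ^ (k + 1)) a b) atTop (𝓝 (∑ k ∈ range n, (Iinf T y ^ (k + 1)) a b)) :=
    tendsto_finsetSum _ fun k _ => tendsto_Imat_pow hT hy (k + 1) a b
  exact le_of_tendsto' hlim hfin

/-- ★★★ **THE RESIDUE OF THE HORIZONTAL-BRIDGE GENERATING FUNCTIONS** (`T ≥ 2`): with the same `u`, `ℓ`, `ρ` as in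
`exists_tendsto_bridgeKernel_residue`, for all levels `a, b`: `(y_T − y) · D_{ab}(y) ⟶ ρ · u_a ℓ_b` as `y ↑ y_T`, where `D_{ab}(y)` is the
total weight of the Duminil-Copin–Hammond horizontal bridges of the strip from level `a` to level `b` at the critical fugacity.
[cite: DuminilCopinHammond2013, §2.2; BeatonBousquetMelouDeGierDuminilCopinGuttmann2014, Corollary 8 (arXiv v5 p. 12); Seneta1973, Chapter 6; lane «pcv-sawmu», a-p2 g18 — own result] -/
theorem exists_tendsto_hKernel_residue (hT : 2 ≤ T) :
    ∃ (IT : Matrix (Fin (2 * T)) (Fin (2 * T)) ℝ) (u ℓ : Fin (2 * T) → ℝ) (ρ : ℝ),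
      (∀ a b, Tendsto (fun y => Iinf T y a b) (𝓝[<] stripYT T) (𝓝 (IT a b))) ∧
      (∀ a, 0 < u a) ∧ (∀ b, 0 < ℓ b) ∧ IT *ᵥ u = u ∧ ℓ ᵥ* IT = ℓ ∧ 0 < ρ ∧
      ∀ a b, Tendsto (fun y => (stripYT T - y) * hKernel T a b y) (𝓝[<] stripYT T) (𝓝 (ρ * (u a * ℓ b))) := by
  have hT1 : 1 ≤ T := by omega
  obtain ⟨IT, u, ℓ, ρ, hI, hu0, hℓ0, hu, hℓ, hρ, hS⟩ := exists_tendsto_bridgeKernel_residue hT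
  refine ⟨IT, u, ℓ, ρ, hI, hu0, hℓ0, hu, hℓ, hρ, fun a b => ?_⟩
  -- `S = (I^0)_{ab} + D_{ab}` and `(y_T − y) (I^0)_{ab} → 0`
  have hev : ∀ᶠ y in 𝓝[<] stripYT T, (stripYT T - y) * ∑' k, (Iinf T y ^ k) a b - (stripYT T - y) * (Iinf T y ^ 0) a b
      = (stripYT T - y) * hKernel T a b y := by
    filter_upwards [Ico_mem_nhdsLT (one_lt_stripYT hT1)] with y hy
    rw [hKernel_eq_tsum_succ hT1 hy, (summable_pow_Iinf_apply hT1 hy a b).tsum_eq_zero_add]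
    ring
  refine Tendsto.congr' hev ?_
  have h0 : Tendsto (fun y => (stripYT T - y) * (Iinf T y ^ 0) a b) (𝓝[<] stripYT T) (𝓝 0) := by
    have hc : ∀ y, (Iinf T y ^ 0) a b = (if a = b then 1 else 0 : ℝ) := fun y => by rw [pow_zero, Matrix.one_apply]
    simp_rw [hc]
    have : Tendsto (fun y : ℝ => (stripYT T - y) * (if a = b then 1 else 0 : ℝ)) (𝓝 (stripYT T))
        (𝓝 ((stripYT T - stripYT T) * (if a = b then 1 else 0 : ℝ))) := (tendsto_const_nhds.sub tendsto_id).mul_const _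
    rw [sub_self, zero_mul] at this
    exact this.mono_left nhdsWithin_le_nhds
  simpa using (hS a b).sub h0

/-- ★★ **Entrance and exit levels decouple**: for all levels `a, b, c, d` (`T ≥ 2`), `D_{ab}(y)/D_{cd}(y) → (u_a ℓ_b)/(u_c ℓ_d)` as `y ↑ y_T`
— the conditional law of the exit level of a critical horizontal bridge given its entrance level converges to `ℓ/Σℓ`, independently of
the entrance level. [cite: DuminilCopinHammond2013, §2.2; Seneta1973, Chapter 6; lane «pcv-sawmu», a-p2 g18 — own result] -/
theorem exists_tendsto_hKernel_ratio (hT : 2 ≤ T) :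
    ∃ (u ℓ : Fin (2 * T) → ℝ), (∀ a, 0 < u a) ∧ (∀ b, 0 < ℓ b) ∧
      ∀ a b c d, Tendsto (fun y => hKernel T a b y / hKernel T c d y) (𝓝[<] stripYT T) (𝓝 (u a * ℓ b / (u c * ℓ d))) := by
  have hT1 : 1 ≤ T := by omega
  obtain ⟨IT, u, ℓ, ρ, -, hu0, hℓ0, -, -, hρ, hD⟩ := exists_tendsto_hKernel_residue hT
  refine ⟨u, ℓ, hu0, hℓ0, fun a b c d => ?_⟩
  have hne : ρ * (u c * ℓ d) ≠ 0 := (mul_pos hρ (mul_pos (hu0 c) (hℓ0 d))).ne'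
  have h := (hD a b).div (hD c d) hne
  have heq : ∀ᶠ y in 𝓝[<] stripYT T, (stripYT T - y) * hKernel T a b y / ((stripYT T - y) * hKernel T c d y)
      = hKernel T a b y / hKernel T c d y := by
    filter_upwards [Ico_mem_nhdsLT (one_lt_stripYT hT1)] with y hy
    rw [mul_div_mul_left _ _ (sub_pos.2 hy.2).ne']
  have hlim : ρ * (u a * ℓ b) / (ρ * (u c * ℓ d)) = u a * ℓ b / (u c * ℓ d) := by
    rw [mul_div_mul_left _ _ hρ.ne']
  rw [← hlim]
  exact h.congr' heq

/-- ★★ **The exit law.** For `T ≥ 2` there is a positive level vector `ℓ` such that for every entrance level `a` and exit level `b`: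
`D_{ab}(y) / Σ_{b'} D_{ab'}(y) → ℓ_b / Σ_{b'} ℓ_{b'}` as `y ↑ y_T` — the law of the exit level of a critical horizontal bridge converges and
does not depend on the entrance level. [cite: DuminilCopinHammond2013, §2.2; Seneta1973, Chapter 6; lane «pcv-sawmu», a-p2 g18 — own result] -/
theorem exists_tendsto_exitLaw (hT : 2 ≤ T) :
    ∃ ℓ : Fin (2 * T) → ℝ, (∀ b, 0 < ℓ b) ∧ ∀ a b,
      Tendsto (fun y => hKernel T a b y / ∑ b', hKernel T a b' y) (𝓝[<] stripYT T) (𝓝 (ℓ b / ∑ b', ℓ b')) := by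
  have hT1 : 1 ≤ T := by omega
  haveI : Nonempty (Fin (2 * T)) := ⟨⟨0, by omega⟩⟩
  obtain ⟨IT, u, ℓ, ρ, -, hu0, hℓ0, -, -, hρ, hD⟩ := exists_tendsto_hKernel_residue hT
  refine ⟨ℓ, hℓ0, fun a b => ?_⟩
  have hsum : Tendsto (fun y => (stripYT T - y) * ∑ b', hKernel T a b' y) (𝓝[<] stripYT T) (𝓝 (ρ * (u a * ∑ b', ℓ b'))) := by
    have h := tendsto_finsetSum (Finset.univ) fun b' (_ : b' ∈ Finset.univ) => hD a b'
    simp only [← Finset.mul_sum] at h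
    convert h using 1
  have hpos : 0 < ∑ b', ℓ b' := Finset.sum_pos (fun b _ => hℓ0 b) Finset.univ_nonempty
  have hne : ρ * (u a * ∑ b', ℓ b') ≠ 0 := (mul_pos hρ (mul_pos (hu0 a) hpos)).ne'
  have h := (hD a b).div hsum hne
  have heq : ∀ᶠ y in 𝓝[<] stripYT T, (stripYT T - y) * hKernel T a b y / ((stripYT T - y) * ∑ b', hKernel T a b' y)
      = hKernel T a b y / ∑ b', hKernel T a b' y := by
    filter_upwards [Ico_mem_nhdsLT (one_lt_stripYT hT1)] with y hy
    rw [mul_div_mul_left _ _ (sub_pos.2 hy.2).ne']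
  have hlim : ρ * (u a * ℓ b) / (ρ * (u a * ∑ b', ℓ b')) = ℓ b / ∑ b', ℓ b' := by
    rw [mul_div_mul_left _ _ hρ.ne', mul_div_mul_left _ _ (hu0 a).ne']
  rw [← hlim]
  exact h.congr' heq

end HV

end Literature.Probability.RandomPlanarGeometry.SAW
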